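import Literature.AnabelianGeometry.SemiGraphs.EmbeddingCriterion
import Literature.AnabelianGeometry.SemiGraphs.ImmersionSheets
import Literature.AnabelianGeometry.SemiGraphs.ZariskiMainTheorem

/-!
# Proof of [SemiAnbd] Theorem 1.2 (i): Zariski's main theorem for semi-graphs, factorization

Mochizuki, *Semi-graphs of anabelioids*, Publ. RIMS **42** (2006) 221–322, §1, Theorem 1.2 (i),
author's manuscript p. 15 [cite: MochizukiSemiAnbd2006, Thm. 1.2(i) p.15]: for an immersion
`φ : G_A → G_B` of finite semi-graphs, "the morphism `φ` factors as the composite of an embedding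
`G_A ↪ G_B'` and a finite graph-covering `G_B' → G_B`."

This file DISCHARGES the named fact `SemiGraph.zariskiMainTheorem_factorization` of
`ZariskiMainTheorem.lean` (statement by abc-iut-L3-t1).  Proof: take the sheet data
`(d, α, β, σ)` of `φ` (`exists_immersionSheets`, file `ImmersionSheets.lean` — the combinatorial
content of the printed route Lemma 1.4 → Lemma 1.5 → pull-back, valid for semi-graphs without the
compactification step (a), (b) of p. 16); let `G_B'` be the *permutation covering* of `G_B` with `d`
sheets twisted by `σ` (vertices, edges, branches of `G_B` times `Fin d`; the branch `(b, k)` abuts to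
`(w, σ_b k)` when `b` abuts to `w`), a finite graph-covering of `G_B` by projection; `G_A` embeds by
`v ↦ (φ v, α v)`, `e ↦ (φ e, β e)` (embedding criterion `isEmbedding_of_injective`: the sheet relations
of `σ` are exactly the compatibility with the coincidence maps, and the disjointness of the `α`- and
`β`-sheets makes the image branch of a non-abutting branch abut to no image vertex).  Proof-only (the
covering is built inside the proof; no definitions).
-/

namespace Literature.AnabelianGeometry.SemiGraphs

namespace SemiGraph

open CategoryTheory

universe u

/-- DISCHARGE of `zariskiMainTheorem_factorization` ([SemiAnbd] Theorem 1.2 (i), "Zariski's Main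
Theorem for Semi-graphs"): an immersion of finite semi-graphs factors as an embedding followed by a
finite graph-covering. [cite: MochizukiSemiAnbd2006, Thm. 1.2(i) p.15] -/
theorem zariskiMainTheorem_factorization_holds : zariskiMainTheorem_factorization.{u} := by
  intro A B φ hA _ hφ
  classical
  obtain ⟨d, α, β, σ, hα, hβ, hαβ, hσv, hσn⟩ := exists_immersionSheets φ hA hφ
  /- (1) the permutation covering `B'` of `B` with `d` sheets twisted by `σ` -/
  let B' : SemiGraph.{u} :=
    { Vertex := B.Vertex × Fin d
      Edge := B.Edge × Fin d
      Branch := B.Branch × Fin d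
      edgeOf := fun x => (B.edgeOf x.1, x.2)
      abuts := fun x => (B.abuts x.1).map fun w => (w, σ x.1 x.2)
      two_branches := by
        rintro ⟨e, k⟩
        obtain ⟨b₁, b₂, hne, h₁, h₂, hall⟩ := B.two_branches e
        refine ⟨(b₁, k), (b₂, k), fun h => hne (congrArg Prod.fst h), Prod.ext h₁ rfl,
          Prod.ext h₂ rfl, fun x hx => ?_⟩
        have hx1 : B.edgeOf x.1 = e := congrArg Prod.fst hx
        have hx2 : x.2 = k := congrArg Prod.snd hx
        rcases hall x.1 hx1 with h | h
        · exact Or.inl (Prod.ext h hx2)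
        · exact Or.inr (Prod.ext h hx2) }
  -- its coincidence maps, unfolded
  have habuts : ∀ (x : B.Branch × Fin d) (y : B.Vertex × Fin d),
      B'.abuts x = some y ↔ B.abuts x.1 = some y.1 ∧ σ x.1 x.2 = y.2 := by
    intro x y
    change (B.abuts x.1).map _ = some y ↔ _
    cases B.abuts x.1 with
    | none => simp
    | some w =>
      simp only [Option.map_some, Option.some.injEq]
      constructor
      · rintro rfl
        exact ⟨rfl, rfl⟩
      · rintro ⟨h1, h2⟩
        exact Prod.ext h1 h2
  /- (2) the projection `π : B' → B`, a finite graph-covering -/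
  let π : B' ⟶ B :=
    { vertexMap := Prod.fst
      edgeMap := Prod.fst
      branchMap := Prod.fst
      edgeOf_branchMap := fun _ => rfl
      branchMap_injOn := fun x y he h => Prod.ext h (by
        have h2 := congrArg Prod.snd he
        exact h2)
      abuts_branchMap := fun x y h => ((habuts x y).1 h).1 }
  have hproper : IsProper π := by
    rintro ⟨e, k⟩
    change B.vertCard e = B'.vertCard (e, k)
    refine Nat.card_congr
      { toFun := fun b => ⟨(b.1, k), Prod.ext b.2.1 rfl, by
          change ((B.abuts b.1).map _).isSome = true
          rw [Option.isSome_map]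
          exact b.2.2⟩
        invFun := fun y => ⟨y.1.1, congrArg Prod.fst y.2.1, by
          have h := y.2.2
          change ((B.abuts y.1.1).map _).isSome = true at h
          rwa [Option.isSome_map] at h⟩
        left_inv := fun b => rfl
        right_inv := fun y => Subtype.ext (Prod.ext rfl (congrArg Prod.snd y.2.1).symm) }
  have hexc : IsExcision π := by
    rintro ⟨w, k⟩
    constructor
    · rintro ⟨x, hx⟩ ⟨x', hx'⟩ h
      have hb : x.1 = x'.1 := congrArg Subtype.val h
      obtain ⟨-, hk⟩ := (habuts x (w, k)).1 hx
      obtain ⟨-, hk'⟩ := (habuts x' (w, k)).1 hx'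
      apply Subtype.ext
      refine Prod.ext hb ((σ x.1).injective ?_)
      change σ x.1 x.2 = σ x.1 x'.2
      rw [hk, ← hk', hb]
    · rintro ⟨b, hb⟩
      refine ⟨⟨(b, (σ b).symm k), (habuts _ (w, k)).2 ⟨hb, (σ b).apply_symm_apply k⟩⟩, rfl⟩
  have hcov : IsFiniteGraphCovering π := by
    refine ⟨⟨hproper, hexc⟩, fun w => ?_, fun e => ?_⟩
    · exact Finite.of_injective (fun x : {x : B.Vertex × Fin d // x.1 = w} => x.1.2)
        fun x y h => Subtype.ext (Prod.ext (x.2.trans y.2.symm) h)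
    · exact Finite.of_injective (fun x : {x : B.Edge × Fin d // x.1 = e} => x.1.2)
        fun x y h => Subtype.ext (Prod.ext (x.2.trans y.2.symm) h)
  /- (3) the embedding `ι : A → B'` by sheets -/
  let ι : A ⟶ B' :=
    { vertexMap := fun v => (φ.vertexMap v, α v)
      edgeMap := fun e => (φ.edgeMap e, β e)
      branchMap := fun c => (φ.branchMap c, β (A.edgeOf c))
      edgeOf_branchMap := fun c => Prod.ext (φ.edgeOf_branchMap c) rfl
      branchMap_injOn := fun c₁ c₂ he h => φ.branchMap_injOn c₁ c₂ he (congrArg Prod.fst h)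
      abuts_branchMap := fun c v h =>
        (habuts _ _).2 ⟨φ.abuts_branchMap c v h, hσv c v h⟩ }
  have hemb : IsEmbedding ι := by
    refine isEmbedding_of_injective ι (fun v₁ v₂ h => hα (congrArg Prod.snd h))
      (fun e₁ e₂ h => hβ (congrArg Prod.snd h)) fun c v' h => ?_
    obtain ⟨-, hk⟩ := (habuts _ _).1 h
    change σ (φ.branchMap c) (β (A.edgeOf c)) = α v' at hk
    cases hc : A.abuts c with
    | none =>
      rw [hσn c hc] at hk
      exact absurd hk.symm (hαβ v' _)
    | some v =>
      rw [hσv c v hc] at hk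
      rw [hα hk]
  exact ⟨B', ι, π, hemb, hcov, SemiGraph.hom_ext _ _ rfl rfl rfl⟩

end SemiGraph

end Literature.AnabelianGeometry.SemiGraphs
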